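import Summits.KontsevichZagierPeriods.KontsevichZagierPeriods.Theorems.MzvKernelInKZTwoPosetsHoffmanDepthOnePolytope
import Summits.KontsevichZagierPeriods.KontsevichZagierPeriods.Theorems.MzvKernelInKZTwoPosetsCubicalChart
import Summits.KontsevichZagierPeriods.KontsevichZagierPeriods.Theorems.FurushoPentagonHoffmanRelationInKZCubicalTransportAux
import Literature.NumberTheory.Transcendental.NashCubes

/-!
# `MzvKernelInKZ` (stmt-KontsevichZagierPeriods-3914), line two-posets-interior-landen: Hoffman's relation in depth one — the forest chart

Support file for the stub `stub_hoffmanDepthOne` of the crux `LinRedNormalForm.MzvKernelInKZ`.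
The FOREST CHART of the order polytope `{1 > w₀ > ⋯ > w_m > 0, 0 < w_{m+1} < w₀}` of the
chain-plus-one poset is the monomial chart

`Ψ(x) = (x₀, x₀x₁, …, x₀x₁⋯x_m, x₀x_{m+1})`   (`v = x₀`, spectators `p_i = x_i`, `r = x_{m+1}`)

of the open cube `(0,1)^{m+2}`: the cubical chart of the chain, and `w_{m+1} = v r` for the extra
element.  It is a bijection onto the polytope with triangular Jacobian `(∏_{j ≤ m} T_j(x)) · x₀`
(`T_k = x₀⋯x_{k-1}`), and the order-polytope integrand `ω_{0^m1}(w₀,…,w_m)/(1 − w_{m+1})` pulls back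
to the LEFT LANDEN integrand `v/((1 − y v)(1 − v r))`, `y = p₁⋯p_m` (`forest_identity`).  Hence
(`stub_hoffmanDepthOneForest`, registered sub-goal) every representation of the order-polytope shape
is KZ-equivalent, by ONE change-of-variables move (rule 2), to every cube representation with the
left Landen integrand, and such a representation exists — both read off the tree's packaged monomial
transport `FurushoPentagon.HoffmanRelationInKZ.monomialChart_transport` (as in this line's
`MzvKernelInKZTwoPosetsCubicalChart`, whose `isSemialgebraic_cube` is reused).  The partial products `T_k`
are threaded as a hypothesis `hT` (the tree's `partialProd_*` spelling); the cubical pull-back in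
blocks (`cubicalFun_one_eq`) is the tree's `stub_cubicalPullback`.

References: M. Kontsevich, D. Zagier, *Periods* (2001), §1.2 rule (2); M. Kaneko, S. Yamamoto,
*A new integral–series identity of multiple zeta values and regularizations*, Selecta Math. 24
(2018), §4.
-/

noncomputable section

namespace Summit.KontsevichZagierPeriods.MzvKernelInKZ.TwoPosets

open Set MeasureTheory
open Literature.NumberTheory.Transcendental
open Summit.KontsevichZagierPeriods.MzvKernelInKZ.Negative

namespace HoffmanDepthOne

/-! ## Partial products `T_k(x) = x₀ ⋯ x_{k-1}` on the cube -/

section TProd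

open Summit.KontsevichZagierPeriods.FurushoPentagon.HoffmanRelationInKZ
  (partialProd_zero partialProd_succ partialProd_pos_le partialProd_succ_lt_one stub_cubicalPullback)

variable {N : ℕ} {T : ℕ → (Fin N → ℝ) → ℝ}
  (hT : ∀ k x, T k x = ∏ j : Fin N, if (j : ℕ) < k then x j else 1)
include hT

/-- On the open cube the partial products are positive. [folklore] -/
theorem T_pos {x : Fin N → ℝ} (hx : x ∈ cube N) (k : ℕ) : 0 < T k x :=
  (partialProd_pos_le T hT (fun i => hx i) k).1

/-- On the open cube of positive dimension the non-empty partial products are `< 1`. [folklore] -/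
theorem T_succ_lt_one {x : Fin N → ℝ} (hx : x ∈ cube N) (hN : 0 < N) (k : ℕ) : T (k + 1) x < 1 :=
  partialProd_succ_lt_one T hT (fun i => hx i) hN k

/-- The cubical Jacobian via partial products: `∏_j x_j^{N-1-j} = ∏_i T_i(x)`. [folklore] -/
theorem prod_pow_eq_prod_T (x : Fin N → ℝ) :
    ∏ j : Fin N, x j ^ (N - 1 - (j : ℕ)) = ∏ i : Fin N, T i x := by
  simp only [hT]
  rw [Finset.prod_comm]
  refine Finset.prod_congr rfl fun j _ => ?_
  rw [Finset.prod_ite, Finset.prod_const_one, mul_one, Finset.prod_const]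
  congr 1
  have : (Finset.univ.filter fun i : Fin N => (j : ℕ) < i) = Finset.Ioi j := by
    ext i
    simp only [Finset.mem_filter, Finset.mem_univ, true_and, Finset.mem_Ioi, Fin.lt_def]
  rw [this, Fin.card_Ioi]

/-- The cubical chart in terms of partial products: `cubicalMap N x i = T_{i+1}(x)`. [folklore] -/
theorem cubicalMap_eq_T (x : Fin N → ℝ) (i : Fin N) : cubicalMap N x i = T ((i : ℕ) + 1) x := by
  rw [hT]
  unfold cubicalMap pprod
  rw [Finset.prod_filter]
  refine Finset.prod_congr rfl fun j _ => ?_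
  by_cases h : (j : ℕ) ≤ i
  · rw [if_pos (Fin.le_def.2 h), if_pos (Nat.lt_succ_of_le h)]
  · rw [if_neg (fun h' => h (Fin.le_def.1 h')), if_neg (fun h' => h (Nat.le_of_lt_succ h'))]

/-- **The cubical pull-back in blocks** (tree theorem `stub_cubicalPullback`): for an index `s` with
positive entries and weight `N`, at a point with non-zero coordinates,
`cubicalFun ω_s 1 x = ∏_l T_{p_l}(x) / (1 − T_{p_{l+1}}(x))`, `p_l = s₁ + ⋯ + s_l`.
[cite: KontsevichZagier2001, §1.2 rule (2)] -/
theorem cubicalFun_one_eq (s : List ℕ) (hs : ∀ a ∈ s, 1 ≤ a) (hw : MZV.weight s = N)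
    (x : Fin N → ℝ) (hx : ∀ i, x i ≠ 0) :
    cubicalFun (bword N s) 1 x =
      ∏ l : Fin s.length, T (s.take l).sum x / (1 - T (s.take ((l : ℕ) + 1)).sum x) := by
  subst hw
  rw [← stub_cubicalPullback s hs T hT x hx]
  unfold cubicalFun
  congr 1
  · rw [mzvIntegrand_eq_wordFun]
    congr 1
    funext i
    exact cubicalMap_eq_T hT x i
  · exact prod_pow_eq_prod_T hT x

end TProd

section TProdTwo

open Summit.KontsevichZagierPeriods.FurushoPentagon.HoffmanRelationInKZ
  (partialProd_zero partialProd_succ)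

variable {m : ℕ} {T : ℕ → (Fin (m + 2) → ℝ) → ℝ}
  (hT : ∀ k x, T k x = ∏ j : Fin (m + 2), if (j : ℕ) < k then x j else 1)
include hT

/-- `T₁ = x₀`. [folklore] -/
theorem T_one (x : Fin (m + 2) → ℝ) : T 1 x = x 0 := by
  rw [partialProd_succ T hT x 0, partialProd_zero T hT, one_mul, dif_pos (Nat.succ_pos _)]
  rfl

/-- `T_{m+1}(x) = (x₁ ⋯ x_m) · x₀` on `ℝ^{m+2}` (the `y v` of the Landen integrands). [folklore] -/
theorem T_chain (x : Fin (m + 2) → ℝ) : T (m + 1) x = (∏ i : Fin m, x i.succ.castSucc) * x 0 := by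
  rw [hT, Fin.prod_univ_castSucc, Fin.prod_univ_succ, Fin.val_last, if_neg (lt_irrefl _), mul_one,
    mul_comm]
  simp only [Fin.val_castSucc, Fin.val_succ, Fin.val_zero, Nat.succ_pos, if_true,
    Fin.castSucc_zero]
  congr 1
  refine Finset.prod_congr rfl fun i _ => ?_
  rw [if_pos (by omega)]

/-- `T_{m+2}(x) = (x₁ ⋯ x_m) · x₀ · x_{m+1}` on `ℝ^{m+2}`. [folklore] -/
theorem T_all (x : Fin (m + 2) → ℝ) :
    T (m + 2) x = (∏ i : Fin m, x i.succ.castSucc) * x 0 * x (Fin.last (m + 1)) := by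
  rw [partialProd_succ T hT x (m + 1), T_chain hT, dif_pos (by omega)]
  rfl

/-! ## The forest chart `Ψ` of the order polytope (rows `S i`; last coordinate `x₀ · x_{m+1}`) -/

variable {S : Fin (m + 2) → Finset (Fin (m + 2))}
  (hS : ∀ i, S i = if i = Fin.last (m + 1) then {0, Fin.last (m + 1)}
    else Finset.univ.filter fun j : Fin (m + 2) => (j : ℕ) ≤ i)

omit hT in
include hS in
/-- The rows of the forest chart are supported on `j ≤ i`. [folklore] -/
theorem S_le : ∀ i, ∀ j ∈ S i, j ≤ i := by
  intro i j hj
  rw [hS] at hj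
  split_ifs at hj with h
  · subst h
    exact Fin.le_last j
  · exact Fin.le_def.2 (Finset.mem_filter.1 hj).2

omit hT in
include hS in
/-- The rows of the forest chart contain the diagonal. [folklore] -/
theorem mem_S : ∀ i, i ∈ S i := by
  intro i
  rw [hS]
  split_ifs with h
  · subst h; simp
  · simp

omit hT in
include hS in
/-- The extra coordinate of the forest chart: `Ψ(x)_{m+1} = x₀ x_{m+1}`. [folklore] -/
theorem C_last (x : Fin (m + 2) → ℝ) :
    ∏ j ∈ S (Fin.last (m + 1)), x j = x 0 * x (Fin.last (m + 1)) := by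
  rw [hS, if_pos rfl, Finset.prod_pair (ne_of_lt Fin.last_pos)]

include hS

/-- Chain coordinates of the forest chart: `Ψ(x)_j = T_{j+1}(x)` for `j ≤ m`. [folklore] -/
theorem C_castSucc (x : Fin (m + 2) → ℝ) (j : Fin (m + 1)) :
    ∏ i ∈ S j.castSucc, x i = T ((j : ℕ) + 1) x := by
  rw [hS, hT, if_neg (Fin.castSucc_lt_last j).ne, Finset.prod_filter]
  refine Finset.prod_congr rfl fun i _ => ?_
  by_cases h : (i : ℕ) ≤ (j : ℕ)
  · rw [if_pos (by simpa using h), if_pos (Nat.lt_succ_of_le h)]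
  · rw [if_neg (by simpa using h), if_neg (fun h' => h (Nat.le_of_lt_succ h'))]

/-- The first coordinate of the forest chart: `Ψ(x)₀ = x₀`. [folklore] -/
theorem C_zero (x : Fin (m + 2) → ℝ) : ∏ j ∈ S 0, x j = x 0 := by
  have h := C_castSucc hT hS x 0
  rwa [Fin.castSucc_zero, Fin.val_zero, T_one hT] at h

/-- The Jacobian of the forest chart is `(∏_{j ≤ m} T_j(x)) · x₀`. [folklore] -/
theorem J_eq (x : Fin (m + 2) → ℝ) :
    ∏ i, ∏ k ∈ (S i).erase i, x k = (∏ j : Fin (m + 1), T j x) * x 0 := by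
  rw [Fin.prod_univ_castSucc]
  congr 1
  · refine Finset.prod_congr rfl fun j _ => ?_
    rw [hS, hT, if_neg (Fin.castSucc_lt_last j).ne]
    have : (Finset.univ.filter fun i : Fin (m + 2) => (i : ℕ) ≤ (j.castSucc : ℕ)).erase
        j.castSucc = Finset.univ.filter fun i : Fin (m + 2) => (i : ℕ) < j := by
      ext i
      simp only [Finset.mem_erase, Finset.mem_filter, Finset.mem_univ, true_and, ne_eq, Fin.ext_iff,
        Fin.val_castSucc]
      omega
    rw [this, Finset.prod_filter]
  · rw [hS, if_pos rfl, Finset.erase_insert_of_ne (ne_of_lt Fin.last_pos), Finset.erase_singleton,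
      Finset.insert_empty, Finset.prod_singleton]

/-- The forest chart maps the open cube into the order polytope
`{1 > w₀ > ⋯ > w_m > 0, 0 < w_{m+1} < w₀}`. [cite: KanekoYamamoto2018, §4] -/
theorem C_mem {x : Fin (m + 2) → ℝ} (hx : x ∈ cube (m + 2)) :
    (fun i => ∏ j ∈ S i, x j) ∈ {w : Fin (m + 2) → ℝ | Fin.init w ∈ simplex (m + 1) ∧
      0 < w (Fin.last (m + 1)) ∧ w (Fin.last (m + 1)) < w 0} := by
  have hpos := T_pos hT hx
  refine ⟨⟨fun j => ?_, fun j => ?_, ?_⟩, ?_, ?_⟩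
  · show 0 < ∏ i ∈ S j.castSucc, x i
    rw [C_castSucc hT hS]; exact hpos _
  · show ∏ i ∈ S j.castSucc, x i < 1
    rw [C_castSucc hT hS]; exact T_succ_lt_one hT hx (Nat.succ_pos _) _
  · rw [Fin.strictAnti_iff_succ_lt]
    intro i
    show ∏ k ∈ S i.succ.castSucc, x k < ∏ k ∈ S i.castSucc.castSucc, x k
    rw [C_castSucc hT hS, C_castSucc hT hS, Fin.val_succ, Fin.val_castSucc,
      partialProd_succ T hT x ((i : ℕ) + 1), dif_pos (by omega)]
    exact mul_lt_of_lt_one_right (hpos _) (hx _).2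
  · show 0 < ∏ j ∈ S (Fin.last (m + 1)), x j
    rw [C_last hS]; exact mul_pos (hx 0).1 (hx _).1
  · show ∏ j ∈ S (Fin.last (m + 1)), x j < ∏ j ∈ S 0, x j
    rw [C_last hS, C_zero hT hS]
    exact mul_lt_of_lt_one_right (hx 0).1 (hx _).2

/-- The forest chart is injective on the open cube (successive quotients). [folklore] -/
theorem injOn_C : InjOn (fun (x : Fin (m + 2) → ℝ) i => ∏ j ∈ S i, x j) (cube (m + 2)) := by
  intro x hx y hy hxy
  have hT' : ∀ k, k ≤ m + 1 → T k x = T k y := by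
    intro k hk
    rcases k with _ | k
    · rw [partialProd_zero T hT, partialProd_zero T hT]
    · have := congrFun hxy (Fin.castSucc ⟨k, by omega⟩)
      simp only at this
      rwa [C_castSucc hT hS, C_castSucc hT hS] at this
  have h0 : x 0 = y 0 := by rw [← T_one hT x, ← T_one hT y]; exact hT' 1 (by omega)
  funext i
  by_cases hi : i = Fin.last (m + 1)
  · subst hi
    have := congrFun hxy (Fin.last (m + 1))
    simp only at this
    rw [C_last hS, C_last hS, h0] at this
    exact mul_left_cancel₀ (hy 0).1.ne' this
  · have hi' : (i : ℕ) < m + 1 := Fin.val_lt_last hi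
    have h1 := hT' ((i : ℕ) + 1) (by omega)
    rw [partialProd_succ T hT x, partialProd_succ T hT y, dif_pos i.isLt, dif_pos i.isLt,
      hT' i hi'.le] at h1
    exact mul_left_cancel₀ (T_pos hT hy _).ne' h1

/-- Every point of the order polytope is the image of a point of the cube under the forest chart
(inverse chart `x₀ = w₀`, `x_i = w_i / w_{i-1}` for `1 ≤ i ≤ m`, `x_{m+1} = w_{m+1} / w₀`). [folklore] -/
theorem exists_preimage_C {w : Fin (m + 2) → ℝ}
    (hw : w ∈ {w : Fin (m + 2) → ℝ | Fin.init w ∈ simplex (m + 1) ∧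
      0 < w (Fin.last (m + 1)) ∧ w (Fin.last (m + 1)) < w 0}) :
    ∃ x ∈ cube (m + 2), (fun i => ∏ j ∈ S i, x j) = w := by
  obtain ⟨⟨h0, h1, ha⟩, hl, hlt⟩ := hw
  -- the coordinates of `w` extended to `ℕ`, and the inverse point
  set W : ℕ → ℝ := fun k => if h : k < m + 2 then w ⟨k, h⟩ else 1 with hW
  have hWk : ∀ k (hk : k ≤ m), W k = Fin.init w ⟨k, by omega⟩ := fun k hk => by
    rw [hW]; simp only; rw [dif_pos (by omega)]; rfl
  have hWpos : ∀ k, k ≤ m → 0 < W k := fun k hk => by rw [hWk k hk]; exact h0 _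
  have hWlt : ∀ k, k ≤ m → W k < 1 := fun k hk => by rw [hWk k hk]; exact h1 _
  have hWdec : ∀ k, 1 ≤ k → k ≤ m → W k < W (k - 1) := fun k hk1 hk => by
    rw [hWk k hk, hWk (k - 1) (by omega)]
    exact ha (Fin.mk_lt_mk.2 (by omega))
  have hW0 : W 0 = w 0 := by rw [hWk 0 (Nat.zero_le m)]; rfl
  set x : Fin (m + 2) → ℝ := fun i => if (i : ℕ) = 0 then w 0
    else if (i : ℕ) = m + 1 then w (Fin.last (m + 1)) / w 0 else W i / W ((i : ℕ) - 1) with hx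
  have hw0 : 0 < w 0 := by rw [← hW0]; exact hWpos 0 (Nat.zero_le m)
  -- telescoping
  have htel : ∀ k, k ≤ m → T (k + 1) x = W k := by
    intro k
    induction k with
    | zero =>
      intro _
      rw [T_one hT, hW0, hx]
      simp
    | succ k ih =>
      intro hk
      rw [partialProd_succ T hT, ih (by omega), dif_pos (by omega)]
      have hne : W k ≠ 0 := (hWpos k (by omega)).ne'
      rw [hx]
      simp only
      rw [if_neg (by simp), if_neg (by omega), Nat.add_sub_cancel]
      field_simp
  refine ⟨x, fun i => ?_, funext fun i => ?_⟩
  · -- the inverse point lies in the cube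
    rw [hx]
    simp only
    split_ifs with h1 h2
    · exact ⟨hw0, by rw [← hW0]; exact hWlt 0 (Nat.zero_le m)⟩
    · exact ⟨div_pos hl hw0, (div_lt_one hw0).2 hlt⟩
    · have hi : (i : ℕ) ≤ m := by have := i.isLt; omega
      exact ⟨div_pos (hWpos _ hi) (hWpos _ (by omega)),
        (div_lt_one (hWpos _ (by omega))).2 (hWdec _ (by omega) hi)⟩
  · -- the chart inverts it
    by_cases hi : i = Fin.last (m + 1)
    · subst hi
      have e0 : x 0 = w 0 := by rw [hx]; simp
      have el : x (Fin.last (m + 1)) = w (Fin.last (m + 1)) / w 0 := by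
        rw [hx]; simp [Fin.val_last]
      rw [C_last hS, e0, el]
      field_simp
    · obtain ⟨j, rfl⟩ := Fin.exists_castSucc_eq.2 hi
      have hj : (j : ℕ) ≤ m := by have := j.isLt; omega
      rw [C_castSucc hT hS, htel j hj, hWk j hj]
      rfl

/-- **The forest chart maps the open cube ONTO the order polytope.** [cite: KanekoYamamoto2018, §4] -/
theorem image_C : (fun (x : Fin (m + 2) → ℝ) i => ∏ j ∈ S i, x j) '' cube (m + 2) =
    {w : Fin (m + 2) → ℝ | Fin.init w ∈ simplex (m + 1) ∧
      0 < w (Fin.last (m + 1)) ∧ w (Fin.last (m + 1)) < w 0} := by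
  refine Subset.antisymm ?_ fun w hw => exists_preimage_C hT hS hw
  rintro _ ⟨x, hx, rfl⟩
  exact C_mem hT hS hx

/-- **The forest-chart identity**: the order-polytope integrand pulled back along `Ψ` times the
Jacobian is the left Landen integrand,
`ω_{0^m1}(Ψ(x)₀, …, Ψ(x)_m)/(1 − x₀x_{m+1}) · |J_Ψ(x)| = v / ((1 − y v)(1 − v r))`.
[cite: KanekoYamamoto2018, Thm 4.1] -/
theorem forest_identity {x : Fin (m + 2) → ℝ} (hx : x ∈ cube (m + 2)) :
    landenLeft m x = wordFun (bword (m + 1) [m + 1]) 1 (Fin.init fun i => ∏ j ∈ S i, x j) /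
      (1 - ∏ j ∈ S (Fin.last (m + 1)), x j) * |∏ i, ∏ k ∈ (S i).erase i, x k| := by
  have hx0 : ∀ i, x i ≠ 0 := fun i => (hx i).1.ne'
  have hpos := T_pos hT hx
  -- partial products in dimension `m + 1` (the chain alone)
  set T' : ℕ → (Fin (m + 1) → ℝ) → ℝ := fun k y => ∏ j : Fin (m + 1), if (j : ℕ) < k then y j else 1
    with hT'def
  have hT' : ∀ k y, T' k y = ∏ j : Fin (m + 1), if (j : ℕ) < k then y j else 1 := fun _ _ => rfl
  have hinit : ∀ k, k ≤ m + 1 → T' k (Fin.init x) = T k x := fun k hk => by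
    rw [hT', hT, Fin.prod_univ_castSucc fun j : Fin (m + 2) => if (j : ℕ) < k then x j else 1,
      Fin.val_last, if_neg (not_lt.2 hk), mul_one]
    rfl
  have hW : wordFun (bword (m + 1) [m + 1]) 1 (Fin.init fun i => ∏ j ∈ S i, x j) *
      ∏ j : Fin (m + 1), T j x = 1 / (1 - T (m + 1) x) := by
    have h1 : (Fin.init fun i => ∏ j ∈ S i, x j) = cubicalMap (m + 1) (Fin.init x) := by
      funext j
      show ∏ i ∈ S j.castSucc, x i = _
      rw [C_castSucc hT hS, cubicalMap_eq_T hT', hinit _ (by omega)]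
    have h2 : ∏ j : Fin (m + 1), T j x = ∏ j : Fin (m + 1), Fin.init x j ^ (m + 1 - 1 - (j : ℕ)) := by
      rw [prod_pow_eq_prod_T hT']
      exact Finset.prod_congr rfl fun j _ => (hinit _ (by omega)).symm
    rw [h1, h2]
    show cubicalFun (bword (m + 1) [m + 1]) 1 (Fin.init x) = _
    rw [cubicalFun_one_eq hT' [m + 1] (by simp) rfl (Fin.init x) fun i => hx0 _]
    simp only [Finset.univ_unique, Fin.default_eq_zero, Fin.isValue, Finset.prod_singleton,
      Fin.val_zero, List.take_zero, List.sum_nil, List.take_succ_cons, List.take_nil, List.sum_cons,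
      add_zero, List.length_singleton, partialProd_zero T' hT']
    rw [hinit _ le_rfl]
  have hJ : |∏ i, ∏ k ∈ (S i).erase i, x k| = (∏ j : Fin (m + 1), T j x) * x 0 := by
    rw [J_eq hT hS, abs_of_pos (mul_pos (Finset.prod_pos fun j _ => hpos _) (hx 0).1)]
  rw [hJ, C_last hS, landenLeft, ← T_chain hT]
  calc x 0 / ((1 - T (m + 1) x) * (1 - x 0 * x (Fin.last (m + 1))))
      = 1 / (1 - T (m + 1) x) * x 0 / (1 - x 0 * x (Fin.last (m + 1))) := by
        rw [one_div_mul_eq_div, div_div]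
    _ = (wordFun (bword (m + 1) [m + 1]) 1 (Fin.init fun i => ∏ j ∈ S i, x j) *
          ∏ j : Fin (m + 1), T j x) * x 0 / (1 - x 0 * x (Fin.last (m + 1))) := by rw [hW]
    _ = _ := by ring

end TProdTwo

/-- **Forest transport** (one change-of-variables move, rule 2, along the forest chart
`Ψ(x) = (x₀, x₀x₁, …, x₀⋯x_m, x₀x_{m+1})`, a monomial chart with triangular Jacobian): every
representation `P` of the order-polytope shape is KZ-equivalent to every representation on the
open cube with the left Landen integrand `v/((1 − yv)(1 − vr))`, `y = p₁⋯p_m`, and such a cube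
representation exists (absolute integrability transported along `Ψ`).  Registered sub-goal of
`stub_hoffmanDepthOne`. [cite: KontsevichZagier2001, §1.2 rule (2)] -/
theorem _root_.Summit.KontsevichZagierPeriods.MzvKernelInKZ.TwoPosets.stub_hoffmanDepthOneForest : ∀ (m : ℕ) (P : KZ.IntegralRep (m + 2)), P.domain = {w : Fin (m + 2) → ℝ | Fin.init w ∈ simplex (m + 1) ∧ 0 < w (Fin.last (m + 1)) ∧ w (Fin.last (m + 1)) < w 0} → EqOn P.integrand (fun w => wordFun (bword (m + 1) [m + 1]) 1 (Fin.init w) / (1 - w (Fin.last (m + 1)))) P.domain → (∃ L : KZ.IntegralRep (m + 2), L.domain = cube (m + 2) ∧ L.integrand = landenLeft m) ∧ ∀ L : KZ.IntegralRep (m + 2), L.domain = cube (m + 2) → EqOn L.integrand (landenLeft m) (cube (m + 2)) → KZ.Equivalent L P := by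
  intro m P hPd hPi
  obtain ⟨T, hT⟩ : ∃ T : ℕ → (Fin (m + 2) → ℝ) → ℝ,
      ∀ k x, T k x = ∏ j : Fin (m + 2), if (j : ℕ) < k then x j else 1 := ⟨_, fun _ _ => rfl⟩
  obtain ⟨S, hS⟩ : ∃ S : Fin (m + 2) → Finset (Fin (m + 2)), ∀ i, S i =
      if i = Fin.last (m + 1) then {0, Fin.last (m + 1)}
      else Finset.univ.filter fun j : Fin (m + 2) => (j : ℕ) ≤ i := ⟨_, fun _ => rfl⟩
  have himage : P.domain = (fun (x : Fin (m + 2) → ℝ) i => ∏ j ∈ S i, x j) '' cube (m + 2) := by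
    rw [image_C hT hS]; exact hPd
  have hPi' : EqOn P.integrand (fun w => wordFun (bword (m + 1) [m + 1]) 1 (Fin.init w) /
      (1 - w (Fin.last (m + 1)))) P.domain := hPi
  obtain ⟨hex, heq⟩ := Summit.KontsevichZagierPeriods.FurushoPentagon.HoffmanRelationInKZ.monomialChart_transport
    S (S_le hS) (mem_S hS) (isSemialgebraic_cube (m + 2)) (fun x i => ∏ j ∈ S i, x j)
    (fun _ _ => rfl) (injOn_C hT hS) (landenLeft m)
    (fun w => wordFun (bword (m + 1) [m + 1]) 1 (Fin.init w) / (1 - w (Fin.last (m + 1))))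
    fun x hx => forest_identity hT hS hx
  exact ⟨hex P himage hPi', fun L hLd hLi => heq L P hLd hLi himage hPi'⟩

end HoffmanDepthOne

end Summit.KontsevichZagierPeriods.MzvKernelInKZ.TwoPosets
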